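import Mathlib.Analysis.SpecialFunctions.Gamma.Beta
import Mathlib.Analysis.Calculus.ParametricIntervalIntegral
import Mathlib.Analysis.SpecialFunctions.Pow.Deriv
import Mathlib.Analysis.Complex.CauchyIntegral
import HarnessLib

/-!
# Euler's integral for Gauss's hypergeometric function: definition, convergence and holomorphy
# on the half-plane `Re z < 1`

For complex parameters with `Re c > Re b > 0` Euler's integral

  `E(a,b;c;z) = Γ(c)/(Γ(b)Γ(c−b)) ∫₀¹ t^{b−1} (1−t)^{c−b−1} (1−zt)^{−a} dt`      (DLMF 15.6.1)

(principal powers) converges for every `z ∈ ℂ ∖ [1, ∞)` and continues `₂F₁(a,b;c;z)` beyond the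
unit disc. This file RESTRICTS to the open half-plane `H = {Re z < 1}` — it contains the unit
disc and the whole negative real axis `z = −x`, `x > 0`, which is what the near-extremal Kerr
throat equation needs (`Literature/Geometry/Lorentzian/NearExtremalThroatHypergeometric.lean`,
cap variable `z = −x → −∞`) — because there `Re(1 − zt) > 0` for all `t ∈ [0,1]`, so the last
factor stays in the right half-plane and no branch bookkeeping is needed. Contents:

* `eulerIntegrand`, `eulerIntegral` (without the Gamma prefactor), `eulerHypergeometric`;
* `re_one_sub_mul_pos`, `one_sub_mul_mem_slitPlane` — `Re(1 − zt) > 0` on `H × [0,1]`;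
* `intervalIntegrable_eulerIntegrand` — convergence for `Re c > Re b > 0`, `Re z < 1`
  (Mathlib's `Complex.betaIntegral_convergent` times a continuous factor);
* `exists_norm_cpow_le` — a uniform bound for `‖(1 − zt)^s‖` on `closedBall z₀ ρ × [0,1]`
  (compactness + continuity; no explicit estimate is claimed);
* `hasDerivAt_eulerIntegral` — differentiation under the integral sign
  (`intervalIntegral.hasDerivAt_integral_of_dominated_loc_of_deriv_le`):
  `d/dz ∫ = a · ∫(a+1, b+1, c+1)`, and `hasDerivAt_eulerHypergeometric` — **DLMF 15.5.1 on `H`**: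
  `E′(a,b;c;z) = (ab/c) E(a+1,b+1;c+1;z)` (`Γ(c+1)/Γ(b+1) = (c/b)Γ(c)/Γ(b)`);
* `differentiableOn_eulerHypergeometric`, `analyticOnNhd_eulerHypergeometric` on `H`.

The identification with the series on `‖z‖ < 1` (DLMF 15.6.1 proper), the hypergeometric
equation on `H` and the real-variable throat corollary are in
`HypergeometricEulerIntegralSeries.lean`. Nothing here is asymptotic (`z → −∞`, DLMF 15.8.2, is
not treated).

References: NIST DLMF (15.6.1), (15.5.1) [DLMF]; Andrews–Askey–Roy, *Special Functions* (1999),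
Thm 2.2.1 [AndrewsAskeyRoy1999].
-/

noncomputable section

open Filter Metric MeasureTheory Set
open scoped Topology

namespace Literature.Analysis.SpecialFunctions.Hypergeometric

/-! ### Definitions -/

/-- Euler's integrand `t^{b−1} (1−t)^{c−b−1} (1 − zt)^{−a}` (principal complex powers of the real
`t ∈ [0,1]`). [cite: DLMF, 15.6.1] -/
def eulerIntegrand (a b c z : ℂ) (t : ℝ) : ℂ :=
  (t : ℂ) ^ (b - 1) * (1 - (t : ℂ)) ^ (c - b - 1) * (1 - z * (t : ℂ)) ^ (-a)

/-- Euler's integral `∫₀¹ t^{b−1} (1−t)^{c−b−1} (1 − zt)^{−a} dt` WITHOUT the Gamma prefactor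
(interval integral; junk where it diverges). [cite: DLMF, 15.6.1] -/
def eulerIntegral (a b c z : ℂ) : ℂ :=
  ∫ t in (0 : ℝ)..1, eulerIntegrand a b c z t

/-- **Euler's hypergeometric function** `E(a,b;c;z) = Γ(c)/(Γ(b)Γ(c−b)) ∫₀¹ t^{b−1}(1−t)^{c−b−1}(1−zt)^{−a} dt`,
the analytic continuation of `₂F₁(a,b;c;z)` for `Re c > Re b > 0` (used on `Re z < 1`).
[cite: DLMF, 15.6.1] -/
def eulerHypergeometric (a b c z : ℂ) : ℂ :=
  Complex.Gamma c / (Complex.Gamma b * Complex.Gamma (c - b)) * eulerIntegral a b c z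

/-! ### The last factor stays in the right half-plane -/

/-- For `Re z < 1` and `t ∈ [0,1]`, `Re(1 − zt) > 0`. [folklore] -/
theorem re_one_sub_mul_pos {z : ℂ} (hz : z.re < 1) {t : ℝ} (ht0 : 0 ≤ t) (ht1 : t ≤ 1) :
    0 < (1 - z * (t : ℂ)).re := by
  have e : (1 - z * (t : ℂ)).re = 1 - z.re * t := by simp [Complex.mul_re]
  rw [e]
  rcases ht0.eq_or_lt with rfl | ht0'
  · simp
  · nlinarith [mul_pos (sub_pos.2 hz) ht0']

/-- For `Re z < 1` and `t ∈ [0,1]`, `1 − zt` lies in the slit plane. [folklore] -/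
theorem one_sub_mul_mem_slitPlane {z : ℂ} (hz : z.re < 1) {t : ℝ} (ht0 : 0 ≤ t) (ht1 : t ≤ 1) :
    1 - z * (t : ℂ) ∈ Complex.slitPlane :=
  Complex.mem_slitPlane_iff.2 (Or.inl (re_one_sub_mul_pos hz ht0 ht1))

/-- Points of `ball z₀ ρ` have `Re z < 1` as soon as `Re z₀ + ρ ≤ 1`. [folklore] -/
theorem re_lt_one_of_mem_ball {z₀ z : ℂ} {ρ : ℝ} (hρ : z₀.re + ρ ≤ 1) (hz : z ∈ ball z₀ ρ) :
    z.re < 1 := by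
  have h1 : ‖z - z₀‖ < ρ := mem_ball_iff_norm.1 hz
  have h2 : (z - z₀).re < ρ := lt_of_le_of_lt ((le_abs_self _).trans (Complex.abs_re_le_norm _)) h1
  rw [Complex.sub_re] at h2
  linarith

/-- Points of `closedBall z₀ ρ` have `Re z < 1` as soon as `Re z₀ + ρ < 1`. [folklore] -/
theorem re_lt_one_of_mem_closedBall {z₀ z : ℂ} {ρ : ℝ} (hρ : z₀.re + ρ < 1)
    (hz : z ∈ closedBall z₀ ρ) : z.re < 1 := by
  have h1 : ‖z - z₀‖ ≤ ρ := mem_closedBall_iff_norm.1 hz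
  have h2 : (z - z₀).re ≤ ρ := ((le_abs_self _).trans (Complex.abs_re_le_norm _)).trans h1
  rw [Complex.sub_re] at h2
  linarith

/-- `t ↦ (1 − zt)^s` is continuous on `[0,1]` for `Re z < 1`. [folklore] -/
theorem continuousOn_one_sub_mul_cpow (s : ℂ) {z : ℂ} (hz : z.re < 1) :
    ContinuousOn (fun t : ℝ => (1 - z * (t : ℂ)) ^ s) (Icc 0 1) := fun _ ht =>
  (ContinuousAt.cpow (f := fun t : ℝ => 1 - z * (t : ℂ)) (g := fun _ => s) (by fun_prop)
    continuousAt_const (one_sub_mul_mem_slitPlane hz ht.1 ht.2)).continuousWithinAt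

/-! ### Convergence -/

/-- **Convergence of Euler's integral**: for `Re c > Re b > 0` and `Re z < 1` the integrand is
interval-integrable on `[0,1]` (Beta-type endpoint singularities `t^{Re b − 1}`,
`(1−t)^{Re(c−b) − 1}` times a continuous factor). [cite: DLMF, 15.6.1] -/
theorem intervalIntegrable_eulerIntegrand (a : ℂ) {b c z : ℂ} (hb : 0 < b.re) (hbc : b.re < c.re)
    (hz : z.re < 1) : IntervalIntegrable (eulerIntegrand a b c z) volume 0 1 := by
  have hβ := Complex.betaIntegral_convergent (u := b) (v := c - b) hb
    (by rw [Complex.sub_re]; linarith)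
  have h := hβ.mul_continuousOn (g := fun t : ℝ => (1 - z * (t : ℂ)) ^ (-a))
    (by rw [uIcc_of_le zero_le_one]; exact continuousOn_one_sub_mul_cpow (-a) hz)
  exact h

/-- The norm of the Beta integrand is interval-integrable on `[0,1]` for `Re c > Re b > 0`.
[folklore] -/
theorem intervalIntegrable_norm_betaIntegrand {b c : ℂ} (hb : 0 < b.re) (hbc : b.re < c.re) :
    IntervalIntegrable (fun t : ℝ => ‖(t : ℂ) ^ (b - 1) * (1 - (t : ℂ)) ^ (c - b - 1)‖)
      volume 0 1 :=
  (Complex.betaIntegral_convergent (u := b) (v := c - b) hb (by rw [Complex.sub_re]; linarith)).norm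

/-! ### A uniform bound for the `z`-dependent factor on compact sets -/

/-- On `closedBall z₀ ρ × [0,1]` with `Re z₀ + ρ < 1` the continuous function `‖(1 − zt)^s‖` is
bounded (compactness; the bound is not made explicit). [folklore] -/
theorem exists_norm_cpow_le (s : ℂ) {z₀ : ℂ} {ρ : ℝ} (hρ : z₀.re + ρ < 1) :
    ∃ C : ℝ, ∀ z ∈ closedBall z₀ ρ, ∀ t ∈ Icc (0 : ℝ) 1, ‖(1 - z * (t : ℂ)) ^ s‖ ≤ C := by
  have hK : IsCompact (closedBall z₀ ρ ×ˢ Icc (0 : ℝ) 1) :=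
    (isCompact_closedBall z₀ ρ).prod isCompact_Icc
  have hcont : ContinuousOn (fun p : ℂ × ℝ => (1 - p.1 * (p.2 : ℂ)) ^ s)
      (closedBall z₀ ρ ×ˢ Icc (0 : ℝ) 1) := by
    intro p hp
    obtain ⟨hpz, hpt⟩ := mem_prod.1 hp
    have hre : p.1.re < 1 := re_lt_one_of_mem_closedBall hρ hpz
    exact (ContinuousAt.cpow (f := fun p : ℂ × ℝ => 1 - p.1 * (p.2 : ℂ)) (g := fun _ => s)
      (by fun_prop) continuousAt_const (one_sub_mul_mem_slitPlane hre hpt.1 hpt.2)).continuousWithinAt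
  obtain ⟨C, hC⟩ := hK.exists_bound_of_continuousOn hcont
  exact ⟨C, fun z hz t ht => hC (z, t) (mk_mem_prod hz ht)⟩

/-! ### Differentiation under the integral sign -/

/-- **Holomorphy of Euler's integral**: for `Re c > Re b > 0` and `Re z₀ < 1`,
`d/dz ∫₀¹ t^{b−1}(1−t)^{c−b−1}(1−zt)^{−a} dt = a ∫₀¹ t^{b}(1−t)^{c−b−1}(1−zt)^{−a−1} dt`, i.e.
`(eulerIntegral a b c)′(z₀) = a · eulerIntegral (a+1) (b+1) (c+1) z₀` (dominated differentiation
under the integral sign, the dominating function being a constant multiple of the Beta integrand).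
[cite: DLMF, 15.6.1] -/
theorem hasDerivAt_eulerIntegral (a : ℂ) {b c : ℂ} (hb : 0 < b.re) (hbc : b.re < c.re) {z₀ : ℂ}
    (hz₀ : z₀.re < 1) :
    HasDerivAt (eulerIntegral a b c) (a * eulerIntegral (a + 1) (b + 1) (c + 1) z₀) z₀ := by
  -- a ball around `z₀` inside the half-plane
  set ρ : ℝ := (1 - z₀.re) / 2 with hρ
  have hρ0 : 0 < ρ := by rw [hρ]; linarith
  have hρ1 : z₀.re + ρ < 1 := by rw [hρ]; linarith
  have hball : ∀ z ∈ ball z₀ ρ, z.re < 1 := fun z hz => re_lt_one_of_mem_ball hρ1.le hz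
  -- the `z`-derivative of the integrand
  set F' : ℂ → ℝ → ℂ := fun z t => (t : ℂ) ^ (b - 1) * (1 - (t : ℂ)) ^ (c - b - 1) *
      (a * (t : ℂ) * (1 - z * (t : ℂ)) ^ (-a - 1)) with hF'
  obtain ⟨C, hC⟩ := exists_norm_cpow_le (-a - 1) hρ1
  have hF_meas : ∀ᶠ z in 𝓝 z₀,
      AEStronglyMeasurable (eulerIntegrand a b c z) (volume.restrict (uIoc 0 1)) :=
    Filter.eventually_of_mem (ball_mem_nhds z₀ hρ0) fun z hz =>
      (intervalIntegrable_eulerIntegrand a hb hbc (hball z hz)).def'.aestronglyMeasurable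
  have hF_int := intervalIntegrable_eulerIntegrand a hb hbc hz₀
  have hF'_eq : ∀ z : ℂ, F' z = fun t : ℝ => eulerIntegrand (a + 1) b c z t * (a * (t : ℂ)) := by
    intro z
    funext t
    simp only [hF', eulerIntegrand]
    rw [show -(a + 1) = -a - 1 by ring]
    ring
  have hF'_int : IntervalIntegrable (F' z₀) volume 0 1 := by
    rw [hF'_eq z₀]
    exact (intervalIntegrable_eulerIntegrand (a + 1) hb hbc hz₀).mul_continuousOn
      (Continuous.continuousOn (by fun_prop))
  have hF'_meas : AEStronglyMeasurable (F' z₀) (volume.restrict (uIoc 0 1)) :=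
    hF'_int.def'.aestronglyMeasurable
  have h_bound : ∀ᵐ t ∂volume, t ∈ uIoc (0 : ℝ) 1 → ∀ z ∈ ball z₀ ρ,
      ‖F' z t‖ ≤ C * ‖a‖ * ‖(t : ℂ) ^ (b - 1) * (1 - (t : ℂ)) ^ (c - b - 1)‖ := by
    refine ae_of_all _ fun t ht z hz => ?_
    rw [uIoc_of_le zero_le_one] at ht
    have hzt := hC z (ball_subset_closedBall hz) t ⟨ht.1.le, ht.2⟩
    have key : ‖a * (t : ℂ) * (1 - z * (t : ℂ)) ^ (-a - 1)‖ ≤ ‖a‖ * C := by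
      rw [norm_mul (a * (t : ℂ)), norm_mul a, Complex.norm_real, Real.norm_eq_abs,
        abs_of_pos ht.1]
      calc ‖a‖ * t * ‖(1 - z * (t : ℂ)) ^ (-a - 1)‖ ≤ ‖a‖ * 1 * C := by
            gcongr
            exact ht.2
        _ = ‖a‖ * C := by ring
    calc ‖F' z t‖ = ‖(t : ℂ) ^ (b - 1) * (1 - (t : ℂ)) ^ (c - b - 1)‖ *
          ‖a * (t : ℂ) * (1 - z * (t : ℂ)) ^ (-a - 1)‖ := by
          simp only [hF']
          exact norm_mul _ _
      _ ≤ ‖(t : ℂ) ^ (b - 1) * (1 - (t : ℂ)) ^ (c - b - 1)‖ * (‖a‖ * C) := by gcongr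
      _ = C * ‖a‖ * ‖(t : ℂ) ^ (b - 1) * (1 - (t : ℂ)) ^ (c - b - 1)‖ := by ring
  have bound_integrable : IntervalIntegrable
      (fun t : ℝ => C * ‖a‖ * ‖(t : ℂ) ^ (b - 1) * (1 - (t : ℂ)) ^ (c - b - 1)‖) volume 0 1 :=
    (intervalIntegrable_norm_betaIntegrand hb hbc).const_mul (C * ‖a‖)
  have h_diff : ∀ᵐ t ∂volume, t ∈ uIoc (0 : ℝ) 1 → ∀ z ∈ ball z₀ ρ,
      HasDerivAt (fun z => eulerIntegrand a b c z t) (F' z t) z := by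
    refine ae_of_all _ fun t ht z hz => ?_
    rw [uIoc_of_le zero_le_one] at ht
    have hslit := one_sub_mul_mem_slitPlane (hball z hz) ht.1.le ht.2
    have h1 : HasDerivAt (fun w : ℂ => 1 - w * (t : ℂ)) (-(1 * (t : ℂ))) z :=
      ((hasDerivAt_id' z).mul_const (t : ℂ)).const_sub 1
    have h2 := h1.cpow_const (c := -a) hslit
    have h3 := h2.const_mul ((t : ℂ) ^ (b - 1) * (1 - (t : ℂ)) ^ (c - b - 1))
    simp only [hF']
    refine h3.congr_deriv ?_
    ring
  have hmain := (intervalIntegral.hasDerivAt_integral_of_dominated_loc_of_deriv_le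
    (ball_mem_nhds z₀ hρ0) hF_meas hF_int hF'_meas h_bound bound_integrable h_diff).2
  -- identify the derivative integral with `a · eulerIntegral (a+1) (b+1) (c+1) z₀`
  have hI : ∫ t in (0 : ℝ)..1, F' z₀ t = a * eulerIntegral (a + 1) (b + 1) (c + 1) z₀ := by
    rw [eulerIntegral, ← intervalIntegral.integral_const_mul]
    refine intervalIntegral.integral_congr_ae (ae_of_all _ fun t ht => ?_)
    rw [uIoc_of_le zero_le_one] at ht
    have ht0 : (t : ℂ) ≠ 0 := Complex.ofReal_ne_zero.2 ht.1.ne'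
    simp only [hF', eulerIntegrand]
    rw [show b + 1 - 1 = (b - 1) + 1 by ring, Complex.cpow_add _ _ ht0, Complex.cpow_one,
      show c + 1 - (b + 1) - 1 = c - b - 1 by ring, show -(a + 1) = -a - 1 by ring]
    ring
  rw [hI] at hmain
  exact hmain

/-- **DLMF 15.5.1 beyond the disc**: for `Re c > Re b > 0` and `Re z < 1`,
`E′(a,b;c;z) = (ab/c) E(a+1,b+1;c+1;z)` for Euler's hypergeometric function (from
`hasDerivAt_eulerIntegral` and `Γ(c+1)/Γ(b+1) = (c/b) Γ(c)/Γ(b)`). [cite: DLMF, 15.5.1] -/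
theorem hasDerivAt_eulerHypergeometric (a : ℂ) {b c : ℂ} (hb : 0 < b.re) (hbc : b.re < c.re)
    {z : ℂ} (hz : z.re < 1) :
    HasDerivAt (eulerHypergeometric a b c)
      (a * b / c * eulerHypergeometric (a + 1) (b + 1) (c + 1) z) z := by
  have h := (hasDerivAt_eulerIntegral a hb hbc hz).const_mul
    (Complex.Gamma c / (Complex.Gamma b * Complex.Gamma (c - b)))
  refine h.congr_deriv ?_
  have hc : 0 < c.re := hb.trans hbc
  have hb0 : b ≠ 0 := fun h => by rw [h, Complex.zero_re] at hb; exact lt_irrefl _ hb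
  have hc0 : c ≠ 0 := fun h => by rw [h, Complex.zero_re] at hc; exact lt_irrefl _ hc
  have hΓb : Complex.Gamma b ≠ 0 := Complex.Gamma_ne_zero_of_re_pos hb
  have hΓc : Complex.Gamma c ≠ 0 := Complex.Gamma_ne_zero_of_re_pos hc
  have hΓcb : Complex.Gamma (c - b) ≠ 0 :=
    Complex.Gamma_ne_zero_of_re_pos (by rw [Complex.sub_re]; linarith)
  rw [eulerHypergeometric, show c + 1 - (b + 1) = c - b by ring, Complex.Gamma_add_one c hc0,
    Complex.Gamma_add_one b hb0]
  field_simp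

/-- The half-plane `{Re z < 1}` is open. [folklore] -/
theorem isOpen_re_lt_one : IsOpen {z : ℂ | z.re < 1} :=
  isOpen_lt Complex.continuous_re continuous_const

/-- The half-plane `{Re z < 1}` is convex (hence preconnected). [folklore] -/
theorem convex_re_lt_one : Convex ℝ {z : ℂ | z.re < 1} :=
  convex_halfSpace_lt Complex.reLm.isLinear 1

/-- The open unit disc lies in the half-plane `{Re z < 1}`. [folklore] -/
theorem ball_subset_re_lt_one : ball (0 : ℂ) 1 ⊆ {z : ℂ | z.re < 1} := fun z hz =>
  lt_of_le_of_lt ((le_abs_self _).trans (Complex.abs_re_le_norm z)) (mem_ball_zero_iff.1 hz)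

/-- Euler's hypergeometric function is complex-differentiable on `{Re z < 1}` for
`Re c > Re b > 0`. [cite: DLMF, 15.6.1] -/
theorem differentiableOn_eulerHypergeometric (a : ℂ) {b c : ℂ} (hb : 0 < b.re)
    (hbc : b.re < c.re) : DifferentiableOn ℂ (eulerHypergeometric a b c) {z : ℂ | z.re < 1} :=
  fun _ hz => (hasDerivAt_eulerHypergeometric a hb hbc hz).differentiableAt.differentiableWithinAt

/-- Euler's hypergeometric function is analytic on `{Re z < 1}` for `Re c > Re b > 0`.
[cite: DLMF, 15.6.1] -/
theorem analyticOnNhd_eulerHypergeometric (a : ℂ) {b c : ℂ} (hb : 0 < b.re) (hbc : b.re < c.re) :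
    AnalyticOnNhd ℂ (eulerHypergeometric a b c) {z : ℂ | z.re < 1} :=
  (differentiableOn_eulerHypergeometric a hb hbc).analyticOnNhd isOpen_re_lt_one

/-- Euler's hypergeometric function is continuous on `{Re z < 1}` for `Re c > Re b > 0`.
[cite: DLMF, 15.6.1] -/
theorem continuousOn_eulerHypergeometric (a : ℂ) {b c : ℂ} (hb : 0 < b.re) (hbc : b.re < c.re) :
    ContinuousOn (eulerHypergeometric a b c) {z : ℂ | z.re < 1} :=
  (differentiableOn_eulerHypergeometric a hb hbc).continuousOn

end Literature.Analysis.SpecialFunctions.Hypergeometric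

end
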